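import Mathlib.Analysis.Matrix.Order
import Mathlib.Analysis.SpecialFunctions.Pow.Real
import HarnessLib

/-!
# The Brauer–Weyl (Jordan–Wigner / Clifford) matrices of Prakash–Sikora–Varvitsiotis–Wei, Theorem 5

Source: A. Prakash, J. Sikora, A. Varvitsiotis, Z. Wei, *Completely positive semidefinite rank*,
Math. Program. 171 (2018) 397–431 = arXiv:1604.07199 [PrakashEtAl2017], §4.1, Theorem 5 (held text
`paper:arxiv-1604.07199`, chunk p13):

"**Theorem 5.** There exists a linear map `γ : ℝⁿ → H^d`, where `d = 2^{⌊n/2⌋}` such that: (i) For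
all `x ∈ ℝⁿ` we have that `tr(γ(x)) = 0`; (ii) For all `x ∈ ℝⁿ` with `‖x‖ = 1` we have `γ(x)² = I_d`;
(iii) For all `x, y ∈ ℝⁿ` we have `d·⟨x,y⟩ = tr(γ(x)γ(y))`. Specifically, when `n = 2ℓ` we define:
`γ(e_i) = Z^{⊗(i−1)} ⊗ X ⊗ I₂^{⊗(ℓ−i)}` (`i ∈ [ℓ]`), and `γ(e_{i+ℓ}) = Z^{⊗(i−1)} ⊗ Y ⊗ I₂^{⊗(ℓ−i)}`
(`i ∈ [ℓ]`) … Lastly, when `n = 2ℓ+1`, we define `γ(e_i)`, `γ(e_{i+ℓ})` for `i ∈ [ℓ]` as above, and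
`γ(e_{2ℓ+1}) = Z^{⊗ℓ}`. … the matrices `{γ(e_i)}` pairwise anti-commute, i.e.
`γ(x)γ(y) + γ(y)γ(x) = 2⟨x,y⟩ I_d`."

This module is the PUBLIC home of the construction that `CompletelyPsdRank.lean` carries privately
for its discharge of Theorems 6′/7 (`exists_lorentz_isometry`); the code below is that construction,
verbatim, with the API made public and Theorem 5 stated stand-alone. The generators are realised on
the index set `Fin ⌊n/2⌋ → Bool` (`|·| = 2^{⌊n/2⌋}`) as signed bit-flip ("monomial") matrices —
`genX i`, `genY i`, `genZ` (the printed Pauli tensor products, with Jordan–Wigner signs), `gen k l`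
(the printed `γ(e_l)` for `ℝ^k`), `gam k x = Σ_l x_l γ(e_l)` — with the API `gam_add`, `gam_smul`,
`gam_isHermitian`, `trace_gam` ((i), for `k ≠ 1`), `gam_anticomm` (the Clifford relation),
`gam_mul_self` (`γ(x)² = ‖x‖² I`, (ii)), `trace_gam_mul_gam` ((iii)), `posSemidef_one_add_gam_iff`
(`cI + γ(x) ⪰ 0 ⟺ ‖x‖ ≤ c`, the key step of Theorem 6), `card_bits` (`d = 2^{⌊k/2⌋}`), and the
stand-alone **`PrakashEtAl2017_thm5`**. SCOPE of (i): `n ≠ 1` — for `n = 1` the printed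
`γ(e₁) = Z^{⊗0} = [1]` has trace `1` (the misprint recorded by `PrakashEtAl2017_thm6_false` in
`CompletelyPsdRank.lean`); (ii), (iii) and the Clifford relation hold for every `n`. Everything is
PROVED; no named facts. (`CompletelyPsdRank.lean` is at the gate's file-size cap, which is why the
construction is re-homed here rather than made public in place; a follow-up whole-file edit of that
file can import this module and drop its private copy.)
-/

noncomputable section

open Matrix Finset
open scoped MatrixOrder ComplexOrder

namespace Literature.Combinatorics.Optimization.Clifford

variable {m : ℕ}

/-! #### Signs and phases -/

/-- The sign of a bit, `Z`'s diagonal: `ff ↦ 1`, `tt ↦ −1`. [cite: PrakashEtAl2017, Thm. 5 (p13)] -/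
private def bsgn (v : Bool) : ℂ := if v then -1 else 1

/-- Flipping a bit flips its sign. [folklore] -/
private theorem bsgn_not (v : Bool) : bsgn (!v) = -bsgn v := by cases v <;> simp [bsgn]

/-- Bit signs square to one. [folklore] -/
private theorem bsgn_mul_self (v : Bool) : bsgn v * bsgn v = 1 := by cases v <;> simp [bsgn]

/-- Bit signs are real. [cite: PrakashEtAl2017, Thm. 5 (p13)] -/
private theorem star_bsgn (v : Bool) : star (bsgn v) = bsgn v := by cases v <;> simp [bsgn]

/-- The two signs of a bit cancel (`Tr Z = 0`). [folklore] -/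
private theorem bsgn_add_bsgn_not (v : Bool) : bsgn v + bsgn (!v) = 0 := by cases v <;> simp [bsgn]

/-- The phase of Pauli `Y` on the row bit: `tt ↦ i`, `ff ↦ −i` (`Y = [[0,−i],[i,0]]`).
[cite: PrakashEtAl2017, Thm. 5 (p13)] -/
private def yph (v : Bool) : ℂ := if v then Complex.I else -Complex.I

/-- Flipping the row bit negates the `Y`-phase. [cite: PrakashEtAl2017, Thm. 5 (p13)] -/
private theorem yph_not (v : Bool) : yph (!v) = -yph v := by cases v <;> simp [yph]

/-- `Y² = I` at the level of phases: `(±i)(∓i) = 1`. [cite: PrakashEtAl2017, Thm. 5 (p13)] -/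
private theorem yph_mul_yph_not (v : Bool) : yph v * yph (!v) = 1 := by
  cases v <;> simp [yph, ← sq, Complex.I_sq]

/-- `Y` is Hermitian at the level of phases: `conj(±i) = ∓i`. [cite: PrakashEtAl2017, Thm. 5 (p13)] -/
private theorem star_yph (v : Bool) : star (yph v) = -yph v := by
  cases v <;> simp [yph, Complex.conj_I]

/-- The two `Y`-phases cancel. [cite: PrakashEtAl2017, Thm. 5 (p13)] -/
private theorem yph_add_yph_not (v : Bool) : yph v + yph (!v) = 0 := by cases v <;> simp [yph]

/-! #### Bit flips -/

/-- Flip bit `i`. [folklore] -/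
private def flip (i : Fin m) (b : Fin m → Bool) : Fin m → Bool := Function.update b i (!b i)

/-- The flipped bit. [folklore] -/
private theorem flip_apply_same (i : Fin m) (b : Fin m → Bool) : flip i b i = !b i := by
  simp [flip]

/-- The other bits are unchanged by a flip. [folklore] -/
private theorem flip_apply_ne {i j : Fin m} (h : j ≠ i) (b : Fin m → Bool) : flip i b j = b j := by
  simp [flip, h]

/-- Flips are involutions. [folklore] -/
private theorem flip_flip (i : Fin m) (b : Fin m → Bool) : flip i (flip i b) = b := by
  funext j
  by_cases h : j = i
  · subst h
    simp [flip_apply_same]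
  · simp [flip_apply_ne h]

/-- Flips commute. [folklore] -/
private theorem flip_comm (i j : Fin m) (b : Fin m → Bool) : flip i (flip j b) = flip j (flip i b) := by
  by_cases hij : i = j
  · subst hij
    rfl
  funext l
  by_cases hi : l = i
  · subst hi
    rw [flip_apply_same, flip_apply_ne hij, flip_apply_ne hij, flip_apply_same]
  · by_cases hj : l = j
    · subst hj
      rw [flip_apply_ne hi, flip_apply_same, flip_apply_same, flip_apply_ne hi]
    · rw [flip_apply_ne hi, flip_apply_ne hj, flip_apply_ne hj, flip_apply_ne hi]

/-- A flip moves every bit string. [folklore] -/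
private theorem flip_ne (i : Fin m) (b : Fin m → Bool) : flip i b ≠ b := by
  intro h
  have := congrFun h i
  rw [flip_apply_same] at this
  cases hb : b i <;> simp [hb] at this

/-! #### Jordan–Wigner signs and the parity -/

/-- The Jordan–Wigner sign `s_i(b) = Π_{j<i} (−1)^{b_j}` (the `Z^{⊗(i−1)}` prefix).
[cite: PrakashEtAl2017, Thm. 5 (p13)] -/
private def jw (i : Fin m) (b : Fin m → Bool) : ℂ := ∏ j ∈ univ.filter (· < i), bsgn (b j)

/-- The parity `ε(b) = Π_j (−1)^{b_j}` (the diagonal of `Z^{⊗m}`). [cite: PrakashEtAl2017, Thm. 5 (p13)] -/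
private def par (b : Fin m → Bool) : ℂ := ∏ j, bsgn (b j)

/-- Effect of a flip on a product of bit signs. [folklore] -/
private theorem prod_bsgn_flip (S : Finset (Fin m)) (i : Fin m) (b : Fin m → Bool) :
    ∏ j ∈ S, bsgn (flip i b j) = (if i ∈ S then -1 else 1) * ∏ j ∈ S, bsgn (b j) := by
  classical
  by_cases hi : i ∈ S
  · rw [if_pos hi, ← Finset.mul_prod_erase S _ hi, ← Finset.mul_prod_erase S (fun j => bsgn (b j)) hi,
      flip_apply_same, bsgn_not]
    have h : ∏ j ∈ S.erase i, bsgn (flip i b j) = ∏ j ∈ S.erase i, bsgn (b j) :=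
      Finset.prod_congr rfl fun j hj => by rw [flip_apply_ne (Finset.ne_of_mem_erase hj)]
    rw [h]
    ring
  · rw [if_neg hi, one_mul]
    exact Finset.prod_congr rfl fun j hj => by
      have hji : j ≠ i := fun h => hi (by rw [← h]; exact hj)
      rw [flip_apply_ne hji]

/-- The Jordan–Wigner sign at `i` ignores bit `i`. [cite: PrakashEtAl2017, Thm. 5 (p13)] -/
private theorem jw_flip_self (i : Fin m) (b : Fin m → Bool) : jw i (flip i b) = jw i b := by
  rw [jw, jw, prod_bsgn_flip]
  simp

/-- Flipping an earlier bit negates the Jordan–Wigner sign (the source of anticommutation). [cite: PrakashEtAl2017, Thm. 5 (p13)] -/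
private theorem jw_flip_of_lt {i j : Fin m} (h : j < i) (b : Fin m → Bool) :
    jw i (flip j b) = -jw i b := by
  rw [jw, jw, prod_bsgn_flip]
  simp [h]

/-- Flipping a later bit does not change the Jordan–Wigner sign. [cite: PrakashEtAl2017, Thm. 5 (p13)] -/
private theorem jw_flip_of_gt {i j : Fin m} (h : i < j) (b : Fin m → Bool) :
    jw i (flip j b) = jw i b := by
  rw [jw, jw, prod_bsgn_flip]
  simp [not_lt.mpr h.le]

/-- Jordan–Wigner signs square to one. [cite: PrakashEtAl2017, Thm. 5 (p13)] -/
private theorem jw_mul_self (i : Fin m) (b : Fin m → Bool) : jw i b * jw i b = 1 := by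
  rw [jw, ← Finset.prod_mul_distrib]
  exact Finset.prod_eq_one fun j _ => bsgn_mul_self _

/-- Jordan–Wigner signs are real. [cite: PrakashEtAl2017, Thm. 5 (p13)] -/
private theorem star_jw (i : Fin m) (b : Fin m → Bool) : star (jw i b) = jw i b := by
  rw [jw, star_prod]
  exact Finset.prod_congr rfl fun j _ => star_bsgn _

/-- A flip negates the parity. [cite: PrakashEtAl2017, Thm. 5 (p13)] -/
private theorem par_flip (i : Fin m) (b : Fin m → Bool) : par (flip i b) = -par b := by
  rw [par, par, prod_bsgn_flip]
  simp

/-- The parity squares to one. [cite: PrakashEtAl2017, Thm. 5 (p13)] -/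
private theorem par_mul_self (b : Fin m → Bool) : par b * par b = 1 := by
  rw [par, ← Finset.prod_mul_distrib]
  exact Finset.prod_eq_one fun j _ => bsgn_mul_self _

/-- The parity is real. [cite: PrakashEtAl2017, Thm. 5 (p13)] -/
private theorem star_par (b : Fin m → Bool) : star (par b) = par b := by
  rw [par, star_prod]
  exact Finset.prod_congr rfl fun j _ => star_bsgn _

/-- `Σ_b ε(b) = 0` for `m ≥ 1` (`Tr Z^{⊗m} = 0`). [cite: PrakashEtAl2017, Thm. 5 (i) (p13)] -/
private theorem sum_par (hm : 0 < m) : ∑ b : Fin m → Bool, par b = 0 := by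
  have h : ∑ b : Fin m → Bool, par b = ∏ _j : Fin m, ∑ v : Bool, bsgn v := by
    rw [Finset.prod_univ_sum]
    simp only [Fintype.piFinset_univ]
    rfl
  rw [h]
  exact Finset.prod_eq_zero (Finset.mem_univ (⟨0, hm⟩ : Fin m)) (by simp [bsgn])

/-! #### Monomial (signed permutation / diagonal) matrices -/

/-- `mono τ φ`: the matrix with entry `φ(b)` at `(b, τ b)` and zeros elsewhere. [folklore] -/
private def mono (τ : (Fin m → Bool) → (Fin m → Bool)) (φ : (Fin m → Bool) → ℂ) :
    Matrix (Fin m → Bool) (Fin m → Bool) ℂ :=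
  Matrix.of fun b c => if c = τ b then φ b else 0

/-- Entries of a monomial matrix. [folklore] -/
private theorem mono_apply (τ : (Fin m → Bool) → (Fin m → Bool)) (φ : (Fin m → Bool) → ℂ) (b c) :
    mono τ φ b c = if c = τ b then φ b else 0 := rfl

/-- Products of monomial matrices are monomial. [folklore] -/
private theorem mono_mul (τ τ' : (Fin m → Bool) → (Fin m → Bool)) (φ φ' : (Fin m → Bool) → ℂ) :
    mono τ φ * mono τ' φ' = mono (τ' ∘ τ) (fun b => φ b * φ' (τ b)) := by
  classical
  ext b c
  rw [Matrix.mul_apply, mono_apply]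
  simp only [mono_apply]
  rw [Finset.sum_eq_single (τ b)]
  · simp only [if_true, Function.comp_apply]
    split_ifs <;> ring
  · intro b' _ hb'
    rw [if_neg hb', zero_mul]
  · intro h
    exact absurd (Finset.mem_univ _) h

/-- Adjoint of a monomial matrix along an involution. [folklore] -/
private theorem mono_conjTranspose (τ : (Fin m → Bool) → (Fin m → Bool)) (φ : (Fin m → Bool) → ℂ)
    (hτ : ∀ b, τ (τ b) = b) : (mono τ φ)ᴴ = mono τ (fun b => star (φ (τ b))) := by
  ext b c
  rw [conjTranspose_apply, mono_apply, mono_apply]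
  by_cases h : c = τ b
  · subst h
    rw [if_pos (hτ b).symm, if_pos rfl]
  · have h' : ¬ b = τ c := fun hb => h (by rw [hb, hτ])
    rw [if_neg h', if_neg h, star_zero]

/-- Monomial matrices with the same pattern add weightwise. [folklore] -/
private theorem mono_add (τ : (Fin m → Bool) → (Fin m → Bool)) (φ ψ : (Fin m → Bool) → ℂ) :
    mono τ φ + mono τ ψ = mono τ (fun b => φ b + ψ b) := by
  ext b c
  simp only [Matrix.add_apply, mono_apply]
  split_ifs <;> ring

/-- A monomial matrix with zero weights vanishes. [folklore] -/
private theorem mono_eq_zero_of (τ : (Fin m → Bool) → (Fin m → Bool)) (φ : (Fin m → Bool) → ℂ)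
    (h : ∀ b, φ b = 0) : mono τ φ = 0 := by
  ext b c
  simp [mono_apply, h]

/-- The diagonal monomial matrix with constant weight is a scalar matrix. [folklore] -/
private theorem mono_id_const (c : ℂ) : mono (m := m) id (fun _ => c) = c • (1 : Matrix _ _ ℂ) := by
  ext b b'
  simp only [mono_apply, id, Matrix.smul_apply, Matrix.one_apply, smul_eq_mul, mul_ite, mul_one,
    mul_zero]
  by_cases h : b' = b
  · subst h; simp
  · simp [h, Ne.symm h]

/-- A monomial matrix along a fixed-point-free map is traceless. [folklore] -/
private theorem trace_mono_of_ne (τ : (Fin m → Bool) → (Fin m → Bool)) (φ : (Fin m → Bool) → ℂ)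
    (h : ∀ b, τ b ≠ b) : (mono τ φ).trace = 0 := by
  simp only [Matrix.trace, Matrix.diag_apply, mono_apply]
  exact Finset.sum_eq_zero fun b _ => if_neg (Ne.symm (h b))

/-- Trace of a diagonal monomial matrix. [folklore] -/
private theorem trace_mono_id (φ : (Fin m → Bool) → ℂ) : (mono id φ).trace = ∑ b, φ b := by
  simp [Matrix.trace, Matrix.diag_apply, mono_apply]

/-- Anticommutation of two monomial matrices from a pointwise identity. [folklore] -/
private theorem mono_anticomm_zero {τ τ' : (Fin m → Bool) → (Fin m → Bool)} {φ φ' : (Fin m → Bool) → ℂ}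
    (hcomm : ∀ b, τ (τ' b) = τ' (τ b)) (h : ∀ b, φ b * φ' (τ b) + φ' b * φ (τ' b) = 0) :
    mono τ φ * mono τ' φ' + mono τ' φ' * mono τ φ = 0 := by
  rw [mono_mul, mono_mul]
  have hτ : (τ ∘ τ' : (Fin m → Bool) → (Fin m → Bool)) = τ' ∘ τ := funext fun b => hcomm b
  rw [hτ, mono_add]
  exact mono_eq_zero_of _ _ h

/-- Square of a monomial involution with unit weights. [folklore] -/
private theorem mono_sq_two {τ : (Fin m → Bool) → (Fin m → Bool)} {φ : (Fin m → Bool) → ℂ}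
    (hτ : ∀ b, τ (τ b) = b) (h : ∀ b, φ b * φ (τ b) = 1) :
    mono τ φ * mono τ φ + mono τ φ * mono τ φ = (2 : ℂ) • (1 : Matrix _ _ ℂ) := by
  rw [mono_mul, mono_add]
  have hid : (τ ∘ τ : (Fin m → Bool) → (Fin m → Bool)) = id := funext fun b => hτ b
  rw [hid, ← mono_id_const]
  congr 1
  funext b
  rw [h]
  norm_num

/-! #### The three kinds of generators: `Z^{⊗(i−1)} ⊗ X ⊗ I`, `Z^{⊗(i−1)} ⊗ Y ⊗ I`, `Z^{⊗m}` -/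

/-- `X`-type generator at position `i`. [cite: PrakashEtAl2017, Thm. 5 eq. (firsthalf) (p13)] -/
def genX (i : Fin m) : Matrix (Fin m → Bool) (Fin m → Bool) ℂ := mono (flip i) (jw i)

/-- `Y`-type generator at position `i`. [cite: PrakashEtAl2017, Thm. 5 eq. (secondhalf) (p13)] -/
def genY (i : Fin m) : Matrix (Fin m → Bool) (Fin m → Bool) ℂ :=
  mono (flip i) (fun b => jw i b * yph (b i))

/-- The extra generator `Z^{⊗m}` for odd dimension. [cite: PrakashEtAl2017, Thm. 5 (p13)] -/
def genZ : Matrix (Fin m → Bool) (Fin m → Bool) ℂ := mono id par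

/-- `X`-type generators are Hermitian. [cite: PrakashEtAl2017, Thm. 5 (p13)] -/
private theorem genX_isHermitian (i : Fin m) : (genX i).IsHermitian := by
  rw [IsHermitian, genX, mono_conjTranspose _ _ (flip_flip i)]
  congr 1
  funext b
  rw [jw_flip_self, star_jw]

/-- `Y`-type generators are Hermitian. [cite: PrakashEtAl2017, Thm. 5 (p13)] -/
private theorem genY_isHermitian (i : Fin m) : (genY i).IsHermitian := by
  rw [IsHermitian, genY, mono_conjTranspose _ _ (flip_flip i)]
  congr 1
  funext b
  rw [star_mul, jw_flip_self, star_jw, flip_apply_same, star_yph, yph_not, neg_neg, mul_comm]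

/-- `Z^{⊗m}` is Hermitian. [cite: PrakashEtAl2017, Thm. 5 (p13)] -/
private theorem genZ_isHermitian : (genZ (m := m)).IsHermitian := by
  rw [IsHermitian, genZ, mono_conjTranspose _ _ (fun b => rfl)]
  congr 1
  funext b
  exact star_par b

/-- `X`-type generators are traceless. [cite: PrakashEtAl2017, Thm. 5 (p13)] -/
private theorem trace_genX (i : Fin m) : (genX i).trace = 0 := trace_mono_of_ne _ _ (flip_ne i)

/-- `Y`-type generators are traceless. [cite: PrakashEtAl2017, Thm. 5 (p13)] -/
private theorem trace_genY (i : Fin m) : (genY i).trace = 0 := trace_mono_of_ne _ _ (flip_ne i)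

/-- `Z^{⊗m}` is traceless for `m ≥ 1`. [cite: PrakashEtAl2017, Thm. 5 (p13)] -/
private theorem trace_genZ (hm : 0 < m) : (genZ (m := m)).trace = 0 := by
  rw [genZ, trace_mono_id]
  exact sum_par hm

-- squares
/-- `X`-type generators square to the identity (doubled form). [cite: PrakashEtAl2017, Thm. 5 (p13)] -/
private theorem genX_sq (i : Fin m) : genX i * genX i + genX i * genX i = (2 : ℂ) • (1 : Matrix _ _ ℂ) :=
  mono_sq_two (flip_flip i) fun b => by rw [jw_flip_self, jw_mul_self]

/-- `Y`-type generators square to the identity (doubled form). [cite: PrakashEtAl2017, Thm. 5 (p13)] -/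
private theorem genY_sq (i : Fin m) : genY i * genY i + genY i * genY i = (2 : ℂ) • (1 : Matrix _ _ ℂ) :=
  mono_sq_two (flip_flip i) fun b => by
    rw [jw_flip_self, flip_apply_same]
    calc jw i b * yph (b i) * (jw i b * yph (!b i)) = (jw i b * jw i b) * (yph (b i) * yph (!b i)) := by
          ring
      _ = 1 := by rw [jw_mul_self, yph_mul_yph_not, one_mul]

/-- `Z^{⊗m}` squares to the identity (doubled form). [cite: PrakashEtAl2017, Thm. 5 (p13)] -/
private theorem genZ_sq : genZ (m := m) * genZ + genZ * genZ = (2 : ℂ) • (1 : Matrix _ _ ℂ) :=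
  mono_sq_two (fun _ => rfl) fun b => par_mul_self b

-- the Jordan–Wigner anticommutation of the signs
/-- The sign identity behind the anticommutation of generators at different positions. [cite: PrakashEtAl2017, Thm. 5 (p13)] -/
private theorem jw_anticomm {i j : Fin m} (hij : i ≠ j) (b : Fin m → Bool) :
    jw i b * jw j (flip i b) + jw j b * jw i (flip j b) = 0 := by
  rcases lt_or_gt_of_ne hij with h | h
  · rw [jw_flip_of_lt h, jw_flip_of_gt h]
    ring
  · rw [jw_flip_of_gt h, jw_flip_of_lt h]
    ring

/-- Distinct `X`-type generators anticommute. [cite: PrakashEtAl2017, Thm. 5 (p13)] -/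
private theorem genX_genX {i j : Fin m} (hij : i ≠ j) : genX i * genX j + genX j * genX i = 0 :=
  mono_anticomm_zero (fun b => flip_comm i j b) fun b => jw_anticomm hij b

/-- Distinct `Y`-type generators anticommute. [cite: PrakashEtAl2017, Thm. 5 (p13)] -/
private theorem genY_genY {i j : Fin m} (hij : i ≠ j) : genY i * genY j + genY j * genY i = 0 :=
  mono_anticomm_zero (fun b => flip_comm i j b) fun b => by
    rw [flip_apply_ne (Ne.symm hij), flip_apply_ne hij]
    calc jw i b * yph (b i) * (jw j (flip i b) * yph (b j)) + jw j b * yph (b j) * (jw i (flip j b) * yph (b i))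
        = yph (b i) * yph (b j) * (jw i b * jw j (flip i b) + jw j b * jw i (flip j b)) := by ring
      _ = 0 := by rw [jw_anticomm hij, mul_zero]

/-- `X`- and `Y`-type generators at different positions anticommute. [cite: PrakashEtAl2017, Thm. 5 (p13)] -/
private theorem genX_genY_of_ne {i j : Fin m} (hij : i ≠ j) : genX i * genY j + genY j * genX i = 0 :=
  mono_anticomm_zero (fun b => flip_comm i j b) fun b => by
    rw [flip_apply_ne (Ne.symm hij)]
    calc jw i b * (jw j (flip i b) * yph (b j)) + jw j b * yph (b j) * jw i (flip j b)
        = yph (b j) * (jw i b * jw j (flip i b) + jw j b * jw i (flip j b)) := by ring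
      _ = 0 := by rw [jw_anticomm hij, mul_zero]

/-- `X`- and `Y`-type generators at the same position anticommute (`XY + YX = 0`). [cite: PrakashEtAl2017, Thm. 5 (p13)] -/
private theorem genX_genY_self (i : Fin m) : genX i * genY i + genY i * genX i = 0 :=
  mono_anticomm_zero (fun b => rfl) fun b => by
    rw [jw_flip_self, flip_apply_same]
    calc jw i b * (jw i b * yph (!b i)) + jw i b * yph (b i) * jw i b
        = jw i b * jw i b * (yph (b i) + yph (!b i)) := by ring
      _ = 0 := by rw [yph_add_yph_not, mul_zero]

/-- `X`-type generators anticommute with `Z^{⊗m}`. [cite: PrakashEtAl2017, Thm. 5 (p13)] -/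
private theorem genX_genZ (i : Fin m) : genX i * genZ + genZ * genX i = 0 :=
  mono_anticomm_zero (fun b => rfl) fun b => by
    rw [par_flip]
    simp only [id]
    ring

/-- `Y`-type generators anticommute with `Z^{⊗m}`. [cite: PrakashEtAl2017, Thm. 5 (p13)] -/
private theorem genY_genZ (i : Fin m) : genY i * genZ + genZ * genY i = 0 :=
  mono_anticomm_zero (fun b => rfl) fun b => by
    rw [par_flip]
    simp only [id]
    ring


/-! #### The family for `ℝ^k`: `k/2` X-type, `k/2` Y-type, and `Z^{⊗(k/2)}` when `k` is odd -/

/-- The `l`-th Brauer–Weyl generator for `ℝ^k` on `{0,1}^{⌊k/2⌋}`: `X`-type for `l < ⌊k/2⌋`, `Y`-type for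
`⌊k/2⌋ ≤ l < 2⌊k/2⌋`, and `Z^{⊗⌊k/2⌋}` for `l = 2⌊k/2⌋` (odd `k`). [cite: PrakashEtAl2017, Thm. 5 (p13)] -/
def gen (k : ℕ) (l : Fin k) : Matrix (Fin (k / 2) → Bool) (Fin (k / 2) → Bool) ℂ :=
  if h : (l : ℕ) < k / 2 then genX ⟨l, h⟩
  else if h' : (l : ℕ) < k / 2 + k / 2 then genY ⟨l - k / 2, by omega⟩
  else genZ

/-- The generators with `l < ⌊k/2⌋` are `X`-type. [cite: PrakashEtAl2017, Thm. 5 (p13)] -/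
private theorem gen_eq_X {k : ℕ} (l : Fin k) (h : (l : ℕ) < k / 2) : gen k l = genX ⟨l, h⟩ := by
  simp [gen, h]

/-- The generators with `⌊k/2⌋ ≤ l < 2⌊k/2⌋` are `Y`-type. [cite: PrakashEtAl2017, Thm. 5 (p13)] -/
private theorem gen_eq_Y {k : ℕ} (l : Fin k) (h : ¬ (l : ℕ) < k / 2) (h' : (l : ℕ) < k / 2 + k / 2) :
    gen k l = genY ⟨l - k / 2, by omega⟩ := by
  simp [gen, h, h']

/-- The last generator for odd `k` is `Z^{⊗⌊k/2⌋}`. [cite: PrakashEtAl2017, Thm. 5 (p13)] -/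
private theorem gen_eq_Z {k : ℕ} (l : Fin k) (h : ¬ (l : ℕ) < k / 2 + k / 2) : gen k l = genZ := by
  have h0 : ¬ (l : ℕ) < k / 2 := by omega
  simp [gen, h0, h]

/-- All generators are Hermitian. [cite: PrakashEtAl2017, Thm. 5 (p13)] -/
theorem gen_isHermitian (k : ℕ) (l : Fin k) : (gen k l).IsHermitian := by
  by_cases h : (l : ℕ) < k / 2
  · rw [gen_eq_X l h]; exact genX_isHermitian _
  by_cases h' : (l : ℕ) < k / 2 + k / 2
  · rw [gen_eq_Y l h h']; exact genY_isHermitian _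
  · rw [gen_eq_Z l h']; exact genZ_isHermitian

/-- Theorem 5 (i): the generators are traceless — for `k ≠ 1` (for `k = 1` the lone generator is
`Z^{⊗0} = [1]`). [cite: PrakashEtAl2017, Thm. 5 (i) (p13)] -/
theorem trace_gen {k : ℕ} (hk : k ≠ 1) (l : Fin k) : (gen k l).trace = 0 := by
  by_cases h : (l : ℕ) < k / 2
  · rw [gen_eq_X l h]; exact trace_genX _
  by_cases h' : (l : ℕ) < k / 2 + k / 2
  · rw [gen_eq_Y l h h']; exact trace_genY _
  · rw [gen_eq_Z l h']
    apply trace_genZ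
    have := l.2
    omega

/-- Theorem 5, the Clifford relations `γ(e_l)γ(e_{l'}) + γ(e_{l'})γ(e_l) = 2δ_{ll'} I`.
[cite: PrakashEtAl2017, Thm. 5 (p13, eq. (clifford))] -/
theorem gen_anticomm (k : ℕ) (l l' : Fin k) :
    gen k l * gen k l' + gen k l' * gen k l = (if l = l' then (2 : ℂ) else 0) • (1 : Matrix _ _ ℂ) := by
  by_cases h1 : (l : ℕ) < k / 2 <;> by_cases h2 : (l' : ℕ) < k / 2
  · -- X X
    rw [gen_eq_X l h1, gen_eq_X l' h2]
    by_cases hll : l = l'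
    · subst hll; rw [if_pos rfl]; exact genX_sq _
    · rw [if_neg hll, zero_smul]
      exact genX_genX fun h => hll (Fin.ext (by simpa using congrArg Fin.val h))
  · -- X, (Y or Z)
    rw [if_neg (show ¬ l = l' from fun h => h2 (h ▸ h1)), zero_smul, gen_eq_X l h1]
    by_cases h2' : (l' : ℕ) < k / 2 + k / 2
    · rw [gen_eq_Y l' h2 h2']
      by_cases hpos : (l : ℕ) = l' - k / 2
      · have : (⟨l, h1⟩ : Fin (k / 2)) = ⟨l' - k / 2, by omega⟩ := Fin.ext hpos
        rw [this]; exact genX_genY_self _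
      · exact genX_genY_of_ne fun h => hpos (by simpa using congrArg Fin.val h)
    · rw [gen_eq_Z l' h2']; exact genX_genZ _
  · -- (Y or Z), X
    rw [if_neg (show ¬ l = l' from fun h => h1 (h ▸ h2)), zero_smul, gen_eq_X l' h2, add_comm]
    by_cases h1' : (l : ℕ) < k / 2 + k / 2
    · rw [gen_eq_Y l h1 h1']
      by_cases hpos : (l' : ℕ) = l - k / 2
      · have : (⟨l', h2⟩ : Fin (k / 2)) = ⟨l - k / 2, by omega⟩ := Fin.ext hpos
        rw [this]; exact genX_genY_self _
      · exact genX_genY_of_ne fun h => hpos (by simpa using congrArg Fin.val h)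
    · rw [gen_eq_Z l h1']; exact genX_genZ _
  · -- (Y or Z), (Y or Z)
    by_cases h1' : (l : ℕ) < k / 2 + k / 2 <;> by_cases h2' : (l' : ℕ) < k / 2 + k / 2
    · rw [gen_eq_Y l h1 h1', gen_eq_Y l' h2 h2']
      by_cases hll : l = l'
      · subst hll; rw [if_pos rfl]; exact genY_sq _
      · rw [if_neg hll, zero_smul]
        refine genY_genY fun h => hll (Fin.ext ?_)
        simp only [Fin.mk.injEq] at h
        omega
    · rw [if_neg (show ¬ l = l' from fun h => h2' (h ▸ h1')), zero_smul, gen_eq_Y l h1 h1', gen_eq_Z l' h2']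
      exact genY_genZ _
    · rw [if_neg (show ¬ l = l' from fun h => h1' (h ▸ h2')), zero_smul, gen_eq_Z l h1', gen_eq_Y l' h2 h2', add_comm]
      exact genY_genZ _
    · have hll : l = l' := Fin.ext (by have := l.2; have := l'.2; omega)
      subst hll
      rw [if_pos rfl, gen_eq_Z l h1']
      exact genZ_sq

/-! #### `γ(x) = Σ_l x_l γ(e_l)` -/

/-- `γ(x)`. [cite: PrakashEtAl2017, Thm. 5 (p13)] -/
def gam (k : ℕ) (x : Fin k → ℝ) : Matrix (Fin (k / 2) → Bool) (Fin (k / 2) → Bool) ℂ :=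
  ∑ l, ((x l : ℝ) : ℂ) • gen k l

/-- `γ` is additive. [cite: PrakashEtAl2017, Thm. 5 (p13)] -/
theorem gam_add (k : ℕ) (x y : Fin k → ℝ) : gam k (x + y) = gam k x + gam k y := by
  simp only [gam, Pi.add_apply, Complex.ofReal_add, add_smul, Finset.sum_add_distrib]

/-- `γ` is homogeneous. [cite: PrakashEtAl2017, Thm. 5 (p13)] -/
theorem gam_smul (k : ℕ) (r : ℝ) (x : Fin k → ℝ) : gam k (r • x) = ((r : ℝ) : ℂ) • gam k x := by
  simp only [gam, Pi.smul_apply, smul_eq_mul, Complex.ofReal_mul, mul_smul, Finset.smul_sum]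

/-- `γ(x)` is Hermitian. [cite: PrakashEtAl2017, Thm. 5 (p13)] -/
theorem gam_isHermitian (k : ℕ) (x : Fin k → ℝ) : (gam k x).IsHermitian := by
  unfold gam
  rw [IsHermitian, conjTranspose_sum]
  refine Finset.sum_congr rfl fun l _ => ?_
  rw [conjTranspose_smul, (gen_isHermitian k l).eq]
  congr 1
  exact Complex.conj_ofReal _

/-- `γ(x)` is traceless for `k ≠ 1` (Theorem 5 (i)). [cite: PrakashEtAl2017, Thm. 5 (p13)] -/
theorem trace_gam {k : ℕ} (hk : k ≠ 1) (x : Fin k → ℝ) : (gam k x).trace = 0 := by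
  simp only [gam, trace_sum, trace_smul, trace_gen hk, smul_zero, Finset.sum_const_zero]

/-- The Clifford relation, bilinear form: `γ(x)γ(y) + γ(y)γ(x) = 2⟨x,y⟩ I`.
[cite: PrakashEtAl2017, Thm. 5 (p13, eq. (clifford))] -/
theorem gam_anticomm (k : ℕ) (x y : Fin k → ℝ) :
    gam k x * gam k y + gam k y * gam k x = ((2 * ∑ l, x l * y l : ℝ) : ℂ) • (1 : Matrix _ _ ℂ) := by
  have hxy : gam k x * gam k y = ∑ l, ∑ l', (((x l : ℝ) : ℂ) * ((y l' : ℝ) : ℂ)) • (gen k l * gen k l') := by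
    simp only [gam, Finset.sum_mul, Finset.mul_sum, smul_mul_smul]
    rw [Finset.sum_comm]
  have hyx : gam k y * gam k x = ∑ l, ∑ l', (((x l : ℝ) : ℂ) * ((y l' : ℝ) : ℂ)) • (gen k l' * gen k l) := by
    simp only [gam, Finset.sum_mul, Finset.mul_sum, smul_mul_smul]
    exact Finset.sum_congr rfl fun l _ => Finset.sum_congr rfl fun l' _ => by rw [mul_comm]
  rw [hxy, hyx, ← Finset.sum_add_distrib]
  simp only [← Finset.sum_add_distrib, ← smul_add, gen_anticomm, smul_smul]
  simp only [mul_ite, mul_zero, ite_smul, zero_smul, Finset.sum_ite_eq, Finset.mem_univ, if_true]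
  rw [← Finset.sum_smul]
  congr 1
  push_cast
  rw [Finset.mul_sum]
  exact Finset.sum_congr rfl fun l _ => by ring

/-- `γ(x)² = ‖x‖² I`. [cite: PrakashEtAl2017, Thm. 6 proof (p13)] -/
theorem gam_mul_self (k : ℕ) (x : Fin k → ℝ) :
    gam k x * gam k x = ((∑ l, x l ^ 2 : ℝ) : ℂ) • (1 : Matrix _ _ ℂ) := by
  have h := gam_anticomm k x x
  rw [← two_smul ℂ (gam k x * gam k x)] at h
  have h2 : (2 : ℂ) • (gam k x * gam k x) = (2 : ℂ) • (((∑ l, x l ^ 2 : ℝ) : ℂ) • (1 : Matrix _ _ ℂ)) := by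
    rw [h, smul_smul]
    congr 1
    push_cast
    rw [Finset.mul_sum, Finset.mul_sum]
    exact Finset.sum_congr rfl fun l _ => by ring
  exact smul_right_injective _ (two_ne_zero) h2

/-- `Tr(γ(x)γ(y)) = d·⟨x,y⟩` (Theorem 5 (iii)). [cite: PrakashEtAl2017, Thm. 5 (iii) (p13)] -/
theorem trace_gam_mul_gam (k : ℕ) (x y : Fin k → ℝ) :
    (gam k x * gam k y).trace = ((∑ l, x l * y l : ℝ) : ℂ) * Fintype.card (Fin (k / 2) → Bool) := by
  have h := congrArg Matrix.trace (gam_anticomm k x y)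
  rw [trace_add, Matrix.trace_mul_comm (gam k y), ← two_mul, trace_smul, trace_one, smul_eq_mul] at h
  have h2 : (2 : ℂ) * (gam k x * gam k y).trace = 2 * (((∑ l, x l * y l : ℝ) : ℂ) * Fintype.card (Fin (k / 2) → Bool)) := by
    rw [h]; push_cast; ring
  exact mul_left_cancel₀ two_ne_zero h2


/-! #### `cI + γ(x) ⪰ 0 ↔ ‖x‖ ≤ c` -/

/-- The value of the quadratic form at a coordinate vector. [folklore] -/
private theorem star_single_dotProduct_mulVec {ι : Type*} [Fintype ι] [DecidableEq ι]
    (M : Matrix ι ι ℂ) (i : ι) :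
    star (Pi.single i 1 : ι → ℂ) ⬝ᵥ (M *ᵥ (Pi.single i 1 : ι → ℂ)) = M i i := by
  have h1 : star (Pi.single i 1 : ι → ℂ) = Pi.single i 1 := by
    ext j
    by_cases h : j = i
    · subst h; simp
    · simp [h]
  rw [h1, Matrix.mulVec_single_one, single_dotProduct, one_mul]
  rfl

/-- **Theorem 6, the key step** ("the eigenvalues of `γ(x)` are `±‖x‖`; consequently `cI + γ(x) ⪰ 0`
iff `c ≥ ‖x‖`"), for `k ≠ 1`; proved without spectra: `‖x‖I + γ(x)` is a nonnegative multiple of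
its own square, and a nonzero column of `‖x‖I − γ(x)` is a `−‖x‖`-eigenvector of `γ(x)`.
[cite: PrakashEtAl2017, Thm. 6 proof (p13)] -/
theorem posSemidef_one_add_gam_iff {k : ℕ} (hk : k ≠ 1) (c : ℝ) (x : Fin k → ℝ) :
    (((c : ℝ) : ℂ) • (1 : Matrix (Fin (k / 2) → Bool) (Fin (k / 2) → Bool) ℂ) + gam k x).PosSemidef ↔
      Real.sqrt (∑ l, x l ^ 2) ≤ c := by
  classical
  set ρ := Real.sqrt (∑ l, x l ^ 2) with hρ
  have hρ0 : 0 ≤ ρ := Real.sqrt_nonneg _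
  have hρsq : ρ ^ 2 = ∑ l, x l ^ 2 := Real.sq_sqrt (Finset.sum_nonneg fun l _ => sq_nonneg _)
  have hgsq : gam k x * gam k x = ((ρ ^ 2 : ℝ) : ℂ) • (1 : Matrix _ _ ℂ) := by rw [gam_mul_self, hρsq]
  have hgH := gam_isHermitian k x
  constructor
  · intro hN
    by_cases hP : ((ρ : ℝ) : ℂ) • (1 : Matrix (Fin (k / 2) → Bool) (Fin (k / 2) → Bool) ℂ) - gam k x = 0
    · -- `γ(x) = ρ I`: traces give `ρ = 0`, and a diagonal entry gives `c ≥ 0`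
      have hgam : gam k x = ((ρ : ℝ) : ℂ) • (1 : Matrix _ _ ℂ) := (sub_eq_zero.mp hP).symm
      have hρz : ρ = 0 := by
        have ht := trace_gam hk x
        rw [hgam, trace_smul, trace_one, smul_eq_mul] at ht
        have hcard : (Fintype.card (Fin (k / 2) → Bool) : ℂ) ≠ 0 :=
          Nat.cast_ne_zero.mpr Fintype.card_ne_zero
        exact_mod_cast (mul_eq_zero.mp ht).resolve_right hcard
      have h0 := (posSemidef_iff_dotProduct_mulVec.mp hN).2 (Pi.single (fun _ => false) 1)
      rw [star_single_dotProduct_mulVec, hgam, hρz] at h0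
      simp only [Matrix.add_apply, Matrix.smul_apply, Matrix.one_apply_eq, smul_eq_mul, mul_one,
        Complex.ofReal_zero, add_zero, Complex.zero_le_real] at h0
      rw [hρz]
      exact h0
    · -- a nonzero column `u` of `ρI − γ(x)` is a `−ρ`-eigenvector of `γ(x)`
      obtain ⟨b₁, b₀, hne⟩ : ∃ b₁ b₀, (((ρ : ℝ) : ℂ) • (1 : Matrix (Fin (k / 2) → Bool) (Fin (k / 2) → Bool) ℂ)
          - gam k x) b₁ b₀ ≠ 0 := by
        by_contra h
        push Not at h
        exact hP (Matrix.ext fun i j => by rw [h i j]; rfl)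
      set P' := ((ρ : ℝ) : ℂ) • (1 : Matrix (Fin (k / 2) → Bool) (Fin (k / 2) → Bool) ℂ) - gam k x
        with hP'
      let u : (Fin (k / 2) → Bool) → ℂ := fun b => P' b b₀
      have hγP : gam k x * P' = -(((ρ : ℝ) : ℂ) • P') := by
        rw [hP', Matrix.mul_sub, Matrix.mul_smul, Matrix.mul_one, hgsq, smul_sub, smul_smul, neg_sub,
          ← Complex.ofReal_mul, ← sq]
      have hγu : gam k x *ᵥ u = -(((ρ : ℝ) : ℂ) • u) := by
        funext b
        have h := congrFun (congrFun hγP b) b₀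
        rw [Matrix.mul_apply] at h
        simp only [Matrix.neg_apply, Matrix.smul_apply, smul_eq_mul] at h
        simp only [mulVec, dotProduct, Pi.neg_apply, Pi.smul_apply, smul_eq_mul, u]
        exact h
      have hNu : (((c : ℝ) : ℂ) • (1 : Matrix _ _ ℂ) + gam k x) *ᵥ u = (((c - ρ : ℝ)) : ℂ) • u := by
        rw [add_mulVec, smul_mulVec, one_mulVec, hγu, Complex.ofReal_sub, sub_smul]
        abel
      have hpos := (posSemidef_iff_dotProduct_mulVec.mp hN).2 u
      rw [hNu, dotProduct_smul, smul_eq_mul] at hpos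
      have hS : star u ⬝ᵥ u = ((∑ b, Complex.normSq (u b) : ℝ) : ℂ) := by
        rw [Complex.ofReal_sum]
        simp only [dotProduct, Pi.star_apply, Complex.star_def, Complex.normSq_eq_conj_mul_self]
      have hSpos : 0 < ∑ b, Complex.normSq (u b) :=
        Finset.sum_pos' (fun b _ => Complex.normSq_nonneg _) ⟨b₁, mem_univ _, Complex.normSq_pos.mpr hne⟩
      rw [hS, ← Complex.ofReal_mul, Complex.zero_le_real] at hpos
      have := (mul_nonneg_iff_of_pos_right hSpos).mp hpos
      linarith
  · intro hc
    have hdecomp : ((c : ℝ) : ℂ) • (1 : Matrix (Fin (k / 2) → Bool) (Fin (k / 2) → Bool) ℂ) + gam k x =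
        (((c - ρ : ℝ)) : ℂ) • 1 + ((((ρ : ℝ)) : ℂ) • 1 + gam k x) := by
      rw [Complex.ofReal_sub, sub_smul]
      abel
    rw [hdecomp]
    refine PosSemidef.add (PosSemidef.one.smul (Complex.zero_le_real.mpr (sub_nonneg.mpr hc))) ?_
    rcases eq_or_lt_of_le hρ0 with hρz | hρpos
    · -- `ρ = 0`: `x = 0`, `γ(x) = 0`
      have hx : ∀ l, x l = 0 := by
        have hs : ∑ l, x l ^ 2 = 0 := by rw [← hρsq, ← hρz]; ring
        intro l
        exact (pow_eq_zero_iff two_ne_zero).mp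
          ((Finset.sum_eq_zero_iff_of_nonneg fun l _ => sq_nonneg (x l)).mp hs l (mem_univ l))
      have hg0 : gam k x = 0 := by simp [gam, hx]
      rw [hg0, add_zero, ← hρz, Complex.ofReal_zero, zero_smul]
      exact PosSemidef.zero
    · -- `P = ρI + γ(x)` satisfies `P = (2ρ)⁻¹ PᴴP`
      set P := (((ρ : ℝ)) : ℂ) • (1 : Matrix (Fin (k / 2) → Bool) (Fin (k / 2) → Bool) ℂ) + gam k x
        with hPdef
      have hPH : Pᴴ = P := by
        rw [hPdef, conjTranspose_add, conjTranspose_smul, conjTranspose_one, hgH.eq, Complex.star_def,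
          Complex.conj_ofReal]
      have hPP : P * P = (((2 * ρ : ℝ)) : ℂ) • P := by
        have hsq1 : P * P = ((ρ * ρ : ℝ) : ℂ) • (1 : Matrix _ _ ℂ) + ((ρ : ℝ) : ℂ) • gam k x +
            ((ρ : ℝ) : ℂ) • gam k x + ((ρ ^ 2 : ℝ) : ℂ) • (1 : Matrix _ _ ℂ) := by
          rw [hPdef]
          simp only [Matrix.add_mul, Matrix.mul_add, Matrix.smul_mul, Matrix.mul_smul, Matrix.one_mul,
            Matrix.mul_one, hgsq, smul_add, smul_smul, ← Complex.ofReal_mul]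
          abel
        rw [hsq1, hPdef, smul_add, smul_smul, ← Complex.ofReal_mul,
          show ((2 * ρ * ρ : ℝ) : ℂ) = ((ρ * ρ : ℝ) : ℂ) + ((ρ ^ 2 : ℝ) : ℂ) by push_cast; ring,
          show ((2 * ρ : ℝ) : ℂ) = ((ρ : ℝ) : ℂ) + ((ρ : ℝ) : ℂ) by push_cast; ring, add_smul, add_smul]
        abel
      have h2ρ : ((2 * ρ : ℝ) : ℂ) ≠ 0 := by exact_mod_cast (by positivity : (2 * ρ : ℝ) ≠ 0)
      have hP : P = ((((2 * ρ)⁻¹ : ℝ)) : ℂ) • (Pᴴ * P) := by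
        rw [hPH, hPP, smul_smul, Complex.ofReal_inv, inv_mul_cancel₀ h2ρ, one_smul]
      rw [hP]
      exact (posSemidef_conjTranspose_mul_self P).smul (Complex.zero_le_real.mpr (by positivity))

/-! #### The dimension `d = 2^{⌊k/2⌋}` -/

/-- `|{0,1}^{⌊k/2⌋}| = 2^{⌊k/2⌋} = d`. [cite: PrakashEtAl2017, Thm. 5 (p13)] -/
theorem card_bits (k : ℕ) : Fintype.card (Fin (k / 2) → Bool) = 2 ^ (k / 2) := by
  simp

/-! #### Theorem 5 as a stand-alone statement -/

/-- Real scalars act on complex matrices through the coercion. [folklore] -/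
private theorem real_smul_eq_coe_smul {ι : Type*} (r : ℝ) (M : Matrix ι ι ℂ) :
    r • M = ((r : ℝ) : ℂ) • M := by
  ext i j
  simp [Matrix.smul_apply, Complex.real_smul]

/-- **PSVW Theorem 5** (p13, quoted in the module docstring), with `H^d` realised on the index set
`Fin ⌊n/2⌋ → Bool` (`|Fin ⌊n/2⌋ → Bool| = 2^{⌊n/2⌋} = d`) by the printed Pauli tensor products
`gen`/`gam`: an `ℝ`-linear map with Hermitian values; (i) `tr γ(x) = 0` for `n ≠ 1` (see the module
docstring for `n = 1`); (ii) `γ(x)² = I` when `‖x‖² = Σ x_l² = 1`; (iii) `tr(γ(x)γ(y)) = d·Σ x_l y_l`;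
and the Clifford relation `γ(x)γ(y) + γ(y)γ(x) = 2⟨x,y⟩ I_d` of the printed proof.
[cite: PrakashEtAl2017, Thm. 5 (p13)] -/
theorem PrakashEtAl2017_thm5 (n : ℕ) :
    ∃ γ : (Fin n → ℝ) →ₗ[ℝ] Matrix (Fin (n / 2) → Bool) (Fin (n / 2) → Bool) ℂ,
      Fintype.card (Fin (n / 2) → Bool) = 2 ^ (n / 2) ∧
      (∀ x, (γ x).IsHermitian) ∧
      (n ≠ 1 → ∀ x, (γ x).trace = 0) ∧
      (∀ x, ∑ l, x l ^ 2 = 1 → γ x * γ x = 1) ∧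
      (∀ x y, (γ x * γ y).trace = ((2 ^ (n / 2) : ℕ) : ℂ) * ((∑ l, x l * y l : ℝ) : ℂ)) ∧
      (∀ x y, γ x * γ y + γ y * γ x = ((2 * ∑ l, x l * y l : ℝ) : ℂ) • (1 : Matrix _ _ ℂ)) := by
  have hcard : Fintype.card (Fin (n / 2) → Bool) = 2 ^ (n / 2) := card_bits n
  let γ : (Fin n → ℝ) →ₗ[ℝ] Matrix (Fin (n / 2) → Bool) (Fin (n / 2) → Bool) ℂ :=
    { toFun := gam n
      map_add' := gam_add n
      map_smul' := fun r x => by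
        rw [gam_smul, RingHom.id_apply, real_smul_eq_coe_smul] }
  refine ⟨γ, hcard, fun x => gam_isHermitian n x, fun hn x => trace_gam hn x, fun x hx => ?_,
    fun x y => ?_, fun x y => gam_anticomm n x y⟩
  · change gam n x * gam n x = 1
    rw [gam_mul_self, hx, Complex.ofReal_one, one_smul]
  · change (gam n x * gam n y).trace = _
    rw [trace_gam_mul_gam, hcard, mul_comm]

end Literature.Combinatorics.Optimization.Clifford
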